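import Literature.NumberTheory.EllipticCurves.ShintaniDefiniteOrbits
import Literature.NumberTheory.EllipticCurves.ShintaniNullStabilizers
import HarnessLib

/-!
# Transport of the Shintani kernel terms under real affine maps and under `S`; the term of `λ XY`

[[cite: Shintani1975, §2 (2.12) and proof of Prop. 2.3 (p. 104)]] — to evaluate the orbit
integral of an INDEFINITE vector the form is moved so that its roots become `0` and `∞`, i.e. the
form becomes `λ XY`; the kernel term of `λ XY` is `λ e(λ²Z) · w · e^{-4π Im Z λ² (Re w/Im w)²}`,
the integrand shape of `ShintaniOrbitIntegrals`.  We PROVE the transformation laws used: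

* `affAct u v x = x ∘ (v u; 0 1)`, `formEval_affAct`, `disc_affAct`, `pw_gAff`, `majorant_gAff`
  (with `gAff` of `ShintaniDefiniteOrbits`), **`shintaniFn_transl`** (`f_{w+u,Z}(x) = f_{w,Z}(x ∘ T_u)`);
* `actM_S` (`x ∘ S = (x₂, -x₁, x₀)`), **`shintaniFn_S`** (`f_{w,Z}(x ∘ S) = w² f_{Sw,Z}(x)`),
  `coe_S_smul`;
* `xyForm λ = (0, λ, 0)` and **`shintaniFn_xyForm`** —
  `f_{w,Z}(λXY) = λ e(λ² Z) · w · exp(-4π Im Z λ² (Re w/Im w)²)`.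

No named facts; the definitions are `affAct` and `xyForm`.
-/

noncomputable section

open scoped MatrixGroups ModularForm Modular Topology
open UpperHalfPlane hiding I
open Complex Filter MeasureTheory Set CongruenceSubgroup ModularGroup Real
open Literature.NumberTheory.EllipticCurves.ModularForms

namespace Literature.NumberTheory.EllipticCurves.Shintani

/-! ### The affine action on forms -/

/-- `x ∘ (v u; 0 1)`: `(x₀v², (2x₀u + x₁)v, x₀u² + x₁u + x₂)`. [folklore] -/
def affAct (u v : ℝ) (x : V) : V := !₂[x 0 * v ^ 2, (2 * x 0 * u + x 1) * v, x 0 * u ^ 2 + x 1 * u + x 2]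

/-- `affAct_zero` (coordinate). [folklore] -/
@[simp] theorem affAct_zero (u v : ℝ) (x : V) : affAct u v x 0 = x 0 * v ^ 2 := by simp [affAct]
/-- `affAct_one` (coordinate). [folklore] -/
@[simp] theorem affAct_one (u v : ℝ) (x : V) : affAct u v x 1 = (2 * x 0 * u + x 1) * v := by simp [affAct]
/-- `affAct_two` (coordinate). [folklore] -/
@[simp] theorem affAct_two (u v : ℝ) (x : V) : affAct u v x 2 = x 0 * u ^ 2 + x 1 * u + x 2 := by simp [affAct]

/-- `x(vw + u, 1) = (x ∘ aff)(w, 1)`. [folklore] -/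
theorem formEval_affAct (u v : ℝ) (x : V) (w : ℂ) :
    formEval x ((v : ℂ) * w + u) = formEval (affAct u v x) w := by
  simp only [formEval, affAct_zero, affAct_one, affAct_two]
  push_cast
  ring

/-- `disc (x ∘ aff) = v² disc x`. [folklore] -/
theorem disc_affAct (u v : ℝ) (x : V) : disc (affAct u v x) = v ^ 2 * disc x := by
  simp only [disc, affAct_zero, affAct_one, affAct_two]
  ring

/-- `p_{vw+u}(x) = p_w(x ∘ aff)/v`. [folklore] -/
theorem pw_gAff (u v : ℝ) (hv : 0 < v) (x : V) (w : ℍ) :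
    pw ((gAff u v hv) • w) x = pw w (affAct u v x) / v := by
  have hvne : v ≠ 0 := hv.ne'
  have hwim : w.im ≠ 0 := w.im_ne_zero
  rw [pw, pw, gAff_smul_im, show ((gAff u v hv) • w).re = ((((gAff u v hv) • w : ℍ) : ℂ)).re from rfl,
    coe_gAff_smul, Complex.normSq_apply, Complex.normSq_apply]
  simp only [add_re, mul_re, ofReal_re, ofReal_im, zero_mul, sub_zero, add_im, mul_im, add_zero,
    UpperHalfPlane.coe_re, UpperHalfPlane.coe_im, affAct_zero, affAct_one, affAct_two]
  field_simp
  ring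

/-- `q⁺_{vw+u}(x) = q⁺_w(x ∘ aff)/v²`. [folklore] -/
theorem majorant_gAff (u v : ℝ) (hv : 0 < v) (x : V) (w : ℍ) :
    majorant ((gAff u v hv) • w) x = majorant w (affAct u v x) / v ^ 2 := by
  have hvne : v ≠ 0 := hv.ne'
  rw [majorant, majorant, pw_gAff, disc_affAct]
  field_simp

/-- **Transport under real translations** (`v = 1`, no rescaling of `Z`):
`f_{w+u,Z}(x) = f_{w,Z}(x ∘ T_u)`. [folklore] -/
theorem shintaniFn_transl (u : ℝ) (x : V) (w Z : ℍ) :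
    shintaniFn ((gAff u 1 one_pos) • w) Z x = shintaniFn w Z (affAct u 1 x) := by
  rw [shintaniFn, shintaniFn, coe_gAff_smul, majorant_gAff, disc_affAct]
  push_cast
  rw [one_mul, ← formEval_affAct]
  push_cast
  simp

/-! ### The inversion `S` -/

/-- `x ∘ S = (x₂, -x₁, x₀)`. [folklore] -/
theorem actM_S (x : V) : actM ModularGroup.S x = !₂[x 2, -x 1, x 0] := by
  unfold actM
  rw [show (ModularGroup.S 0 0 : ℤ) = 0 from rfl, show (ModularGroup.S 0 1 : ℤ) = -1 from rfl,
    show (ModularGroup.S 1 0 : ℤ) = 1 from rfl, show (ModularGroup.S 1 1 : ℤ) = 0 from rfl]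
  ext i
  fin_cases i <;> simp [actV]

/-- **Transport under `S`**: `f_{w,Z}(x ∘ S) = w² f_{Sw,Z}(x)` (`Sw = -1/w`). [folklore] -/
theorem shintaniFn_S (x : V) (w Z : ℍ) :
    shintaniFn w Z (!₂[x 2, -x 1, x 0]) = ((w : ℂ)) ^ 2 * shintaniFn (ModularGroup.S • w) Z x := by
  rw [← actM_S]
  have h := shintaniFn_sl_smul ModularGroup.S w Z x
  change shintaniFn w Z (actM ModularGroup.S x) = _ at h
  rw [h, show (ModularGroup.S 1 0 : ℤ) = 1 from rfl, show (ModularGroup.S 1 1 : ℤ) = 0 from rfl]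
  push_cast
  rw [one_mul, add_zero]

/-- The coordinate of `S w`: `-1/w`. [folklore] -/
theorem coe_S_smul (w : ℍ) : (((ModularGroup.S • w : ℍ)) : ℂ) = (-(w : ℂ))⁻¹ := by
  rw [UpperHalfPlane.modular_S_smul]

/-! ### The standard split form `λ XY` -/

/-- The vector `(0, λ, 0)` (the form `λ XY`, roots `0` and `∞`). [folklore] -/
def xyForm (lam : ℝ) : V := !₂[0, lam, 0]

/-- **The kernel term of `λ XY`**: `f_{w,Z}(λXY) = λ w e(λ² Z) e^{-4π Im Z λ² (Re w/Im w)²}`.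
[folklore] -/
theorem shintaniFn_xyForm (w Z : ℍ) (lam : ℝ) :
    shintaniFn w Z (xyForm lam) = ((lam : ℂ) * cexp (2 * π * I * (lam ^ 2 : ℝ) * (Z : ℂ))) *
      (w : ℂ) * (Real.exp (-(4 * π * (Z : ℂ).im * lam ^ 2) * ((w : ℂ).re / (w : ℂ).im) ^ 2) : ℂ) := by
  have hform : formEval (xyForm lam) w = lam * (w : ℂ) := by simp [formEval, xyForm]
  have hdisc : disc (xyForm lam) = lam ^ 2 := by simp [disc, xyForm]
  have hpw : pw w (xyForm lam) = lam * (w : ℂ).re / (w : ℂ).im := by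
    simp only [pw, xyForm]
    simp [UpperHalfPlane.coe_re, UpperHalfPlane.coe_im]
  have hmaj : majorant w (xyForm lam) = lam ^ 2 + 2 * (lam * (w : ℂ).re / (w : ℂ).im) ^ 2 := by
    rw [majorant, hdisc, hpw]
  rw [shintaniFn, hform, hmaj, hdisc, Complex.ofReal_exp]
  set B : ℝ := -(4 * π * (Z : ℂ).im * lam ^ 2) * ((w : ℂ).re / (w : ℂ).im) ^ 2 with hB
  have hZ : (((Z : ℂ).re : ℂ)) + (((Z : ℂ).im : ℂ)) * I = (Z : ℂ) := Complex.re_add_im _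
  have key : cexp (2 * π * I * ((((Z : ℂ).re : ℂ)) * ((lam ^ 2 : ℝ) : ℂ) +
      I * ((((Z : ℂ).im : ℂ)) * ((lam ^ 2 + 2 * (lam * (w : ℂ).re / (w : ℂ).im) ^ 2 : ℝ) : ℂ)))) =
      cexp (2 * π * I * ((lam ^ 2 : ℝ) : ℂ) * ((((Z : ℂ).re : ℂ)) + (((Z : ℂ).im : ℂ)) * I)) * cexp (B : ℂ) := by
    rw [← Complex.exp_add]
    congr 1
    rw [hB]
    push_cast
    ring_nf
    rw [Complex.I_sq]
    ring
  rw [hZ] at key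
  rw [key]
  ring

end Literature.NumberTheory.EllipticCurves.Shintani
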